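import Summits.CriticalPhenomena.PercolationContinuityZ3.Theorems.Transplant.PlanarCells2EfarN2
import Summits.CriticalPhenomena.PercolationContinuityZ3.Theorems.Transplant.PlanarCells2FaceRows
import Summits.CriticalPhenomena.PercolationContinuityZ3.Theorems.Transplant.PlanarCells2Sep
import HarnessLib

/-!
# N1 ({±1} node), (F) column, planar part F1′ (hp-8 g33): the fresh far rows of the FACE STEP one unit inside the slack far region —
# `PCells2.farAN₂` (transverse half-width `5r⊥ − 2`, inside `EfarN₂`) and `PCells2.farAS₂` (one unit inside it, `5r⊥ − 3`) — twins of `farAN/farAS` (L1′)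

builds on p205010 (kernel theorem, internal audit signed; external expert review pending) — nothing in this file uses p205010; pure planar arithmetic.
Lane `prim-bschramm`, seat `prim-hp-8` (gen 33); helper file (`--supports stmt-CriticalPhenomena-4575 --as helper`).
WHY.  The N1 scheme's far region is `C.Efar = VWin ψ (EfarN₂ …)` (`cellGeomSG₂`, SkelPhiCellsWeakG); the face-step region must lie in it with its planar
1-thickening (`Win_farAS_subset_Efar` in SkelPhiConcFaceRegion), so the D″ rows `farAN`/`farAS` move one unit inwards across.  Everything along the axis is
unchanged (levels `5r∥ + 10s∥j + 1/2 … 25r∥/25r∥ − 1`); the transverse facts need `r⊥ ≥ 2` at most (`PCells2`: `r = K·s ≥ 20`).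
* `farAN₂`, `farAS₂`; `farAN₂_subset_farAN`, `farAS₂_subset_farAS`, `farAS₂_subset_farAN₂`, `farAN₂_subset_EfarN₂`, `farAS₂_subset_EfarN₂`, **`mem_EfarN₂_of_near_farAS₂`**,
  **`mem_farAN₂_of_near_farAS₂`**, `M_add_stepVec_subset_farAS₂` (`j ≤ K`), `faceRow_subset_farAS₂` / `faceRow_enlarge_subset_farAS₂` (`j + 1 ≤ K`), `Q_sepInf_farAS₂`,
  `Stub_sepInf_farAS₂`, `farAN₂_disjoint_Stub`, `farAS₂_disjoint_Q`, the level bounds `le_lev_of_mem_farAS₂(')`, `lev_le_of_mem_farAS₂`, `bounds_of_mem_farAS₂`.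
[cite: KozmaNitzan2024, §4 p. 26 (E_{v,x}), p. 30 (the rows above H^j)] [folklore]
-/

namespace Summit.CriticalPhenomena.PercolationContinuityZ3.Theorems.Transplant

open Literature.Probability.Percolation Literature.Probability.LatticeModels
open Literature.Probability.Percolation.KozmaNitzan
open Literature.Probability.Percolation.KozmaNitzan.Cells (oth oth_ne sgOf sgOf_sign stepVec_apply_fst stepVec_apply_oth eq_oth_of_ne oth_oth)
open PlanarSkeleton (SepInf)
open PCells (mem_psBox_iff)

namespace PCells2

variable (P : PCells2)

/-- **The fresh rows above the stub of level `j`, one unit in across**: `cen x + {5r∥ + 10 s∥ j + 1 ≤ level ≤ 25 r∥} × [±(5r⊥−2)]`. [cite: KozmaNitzan2024, §4 p. 30] -/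
noncomputable def farAN₂ (x : Site 2) (du : MDir) (j : ℕ) : Finset (Site 2) :=
  sBox du.1 (sgOf du) (P.cen x) (5 * P.r du.1 + 10 * P.s du.1 * j + 1) (25 * P.r du.1) (5 * P.r (oth du.1) - 2)

/-- **The shrunk fresh rows, one unit in across**: `cen x + {5r∥ + 10 s∥ j + 2 ≤ level ≤ 25 r∥ − 1} × [±(5r⊥−3)]` (one unit inside `farAN₂` on every side).
[cite: KozmaNitzan2024, §4 p. 30] -/
noncomputable def farAS₂ (x : Site 2) (du : MDir) (j : ℕ) : Finset (Site 2) :=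
  sBox du.1 (sgOf du) (P.cen x) (5 * P.r du.1 + 10 * P.s du.1 * j + 2) (25 * P.r du.1 - 1) (5 * P.r (oth du.1) - 3)

/-- `farAN₂ ⊆ farAN`. [folklore] -/
theorem farAN₂_subset_farAN (x : Site 2) (du : MDir) (j : ℕ) : P.farAN₂ x du j ⊆ P.farAN x du j := by
  intro t ht; rw [farAN₂, mem_psBox_iff] at ht; rw [farAN, mem_psBox_iff]; exact ⟨ht.1, by omega, by omega⟩

/-- `farAS₂ ⊆ farAS`. [folklore] -/
theorem farAS₂_subset_farAS (x : Site 2) (du : MDir) (j : ℕ) : P.farAS₂ x du j ⊆ P.farAS x du j := by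
  intro t ht; rw [farAS₂, mem_psBox_iff] at ht; rw [farAS, mem_psBox_iff]; exact ⟨ht.1, by omega, by omega⟩

/-- `farAS₂ ⊆ farAN₂`. [folklore] -/
theorem farAS₂_subset_farAN₂ (x : Site 2) (du : MDir) (j : ℕ) : P.farAS₂ x du j ⊆ P.farAN₂ x du j := by
  intro t ht; rw [farAS₂, mem_psBox_iff] at ht; rw [farAN₂, mem_psBox_iff]; exact ⟨⟨by omega, by omega⟩, by omega, by omega⟩

/-- `farAN₂ ⊆ EfarN₂`. [folklore] -/
theorem farAN₂_subset_EfarN₂ (x : Site 2) (du : MDir) (j : ℕ) : P.farAN₂ x du j ⊆ P.EfarN₂ x du := by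
  intro t ht
  rw [farAN₂, mem_psBox_iff] at ht
  rw [EfarN₂, mem_psBox_iff]
  have : (0 : ℤ) ≤ 10 * P.s du.1 * j := by positivity
  exact ⟨⟨by omega, by omega⟩, by omega, by omega⟩

/-- `farAS₂ ⊆ EfarN₂`. [folklore] -/
theorem farAS₂_subset_EfarN₂ (x : Site 2) (du : MDir) (j : ℕ) : P.farAS₂ x du j ⊆ P.EfarN₂ x du :=
  (P.farAS₂_subset_farAN₂ x du j).trans (P.farAN₂_subset_EfarN₂ x du j)

/-- **The planar 1-thickening of `farAS₂` lies in `farAN₂`.** [folklore] -/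
theorem mem_farAN₂_of_near_farAS₂ {x : Site 2} {du : MDir} {j : ℕ} {t t' : Site 2} (ht : t ∈ P.farAS₂ x du j) (h : ∀ i, |t' i - t i| ≤ 1) :
    t' ∈ P.farAN₂ x du j := by
  rw [farAS₂, mem_psBox_iff] at ht
  rw [farAN₂, mem_psBox_iff]
  have h1 := abs_le.1 (h du.1)
  have h2 := abs_le.1 (h (oth du.1))
  refine ⟨?_, by omega⟩
  rcases sgOf_sign du with hs | hs <;> rw [hs] at ht ⊢ <;> constructor <;> nlinarith [ht.1.1, ht.1.2]

/-- **The planar 1-thickening of `farAS₂` lies in `EfarN₂`.** [folklore] -/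
theorem mem_EfarN₂_of_near_farAS₂ {x : Site 2} {du : MDir} {j : ℕ} {t t' : Site 2} (ht : t ∈ P.farAS₂ x du j) (h : ∀ i, |t' i - t i| ≤ 1) :
    t' ∈ P.EfarN₂ x du :=
  P.farAN₂_subset_EfarN₂ x du j (P.mem_farAN₂_of_near_farAS₂ ht h)

/-- Level and transverse bounds of a point of `farAS₂`. [folklore] -/
theorem bounds_of_mem_farAS₂ {x : Site 2} {du : MDir} {j : ℕ} {t : Site 2} (ht : t ∈ P.farAS₂ x du j) :
    5 * (P.r du.1 : ℤ) + 10 * P.s du.1 * j + 2 ≤ P.lev du x t ∧ P.lev du x t ≤ 25 * P.r du.1 - 1 ∧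
      |t (oth du.1) - P.cen x (oth du.1)| ≤ 5 * P.r (oth du.1) - 3 := by
  rw [farAS₂, mem_psBox_iff] at ht
  unfold lev
  exact ⟨ht.1.1, ht.1.2, abs_le.2 ⟨by omega, by omega⟩⟩

/-- Membership in `farAS₂` from the level and the transverse bound. [folklore] -/
theorem mem_farAS₂_of_bounds {x : Site 2} {du : MDir} {j : ℕ} {t : Site 2} (h1 : 5 * (P.r du.1 : ℤ) + 10 * P.s du.1 * j + 2 ≤ P.lev du x t)
    (h2 : P.lev du x t ≤ 25 * P.r du.1 - 1) (h3 : |t (oth du.1) - P.cen x (oth du.1)| ≤ 5 * P.r (oth du.1) - 3) : t ∈ P.farAS₂ x du j := by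
  rw [farAS₂, mem_psBox_iff]
  unfold lev at h1 h2
  have := abs_le.1 h3
  exact ⟨⟨h1, h2⟩, by omega, by omega⟩

/-- Points of `farAS₂` have level `≥ 5r∥ + 2`. [folklore] -/
theorem le_lev_of_mem_farAS₂ {x : Site 2} {du : MDir} {j : ℕ} {t : Site 2} (ht : t ∈ P.farAS₂ x du j) : 5 * (P.r du.1 : ℤ) + 2 ≤ P.lev du x t := by
  have h := (P.bounds_of_mem_farAS₂ ht).1
  have : (0 : ℤ) ≤ 10 * P.s du.1 * j := by positivity
  omega

/-- Points of `farAS₂` have level `≤ 25r∥ − 1`. [folklore] -/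
theorem lev_le_of_mem_farAS₂ {x : Site 2} {du : MDir} {j : ℕ} {t : Site 2} (ht : t ∈ P.farAS₂ x du j) : P.lev du x t ≤ 25 * P.r du.1 - 1 :=
  (P.bounds_of_mem_farAS₂ ht).2.1

/-- `M(x + du) ⊆ farAS₂ x du j` for `j ≤ K` (transversally `3r⊥ ≤ 5r⊥ − 3`). [cite: KozmaNitzan2024, §4 p. 26 (M_x)] -/
theorem M_add_stepVec_subset_farAS₂ (x : Site 2) (du : MDir) {j : ℕ} (hj : j ≤ P.K) : P.M (x + stepVec du) ⊆ P.farAS₂ x du j := by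
  intro t ht
  have ht' := P.M_add_stepVec_subset_farAS x du hj ht
  rw [farAS, mem_psBox_iff] at ht'
  rw [M, mem_abox_iff] at ht
  have h2 := ht (oth du.1)
  rw [P.cen_add_stepVec_oth] at h2
  push_cast at h2
  have hr : (2 : ℤ) ≤ P.r (oth du.1) := by have h20 := P.twenty_mul_s_le_r (oth du.1); have hs := P.hs (oth du.1); omega
  rw [farAS₂, mem_psBox_iff]
  exact ⟨ht'.1, by omega, by omega⟩

/-- The face row `F^{j+1}` lies in `farAS₂ x du j` (`j + 1 ≤ K`; transversally `2r⊥ ≤ 5r⊥ − 3`). [cite: KozmaNitzan2024, §4 p. 30] -/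
theorem faceRow_subset_farAS₂ (x : Site 2) (du : MDir) {j : ℕ} (hj : j + 1 ≤ P.K) :
    Finset.Icc (P.faceLo x du j) (P.faceHi x du j) ⊆ P.farAS₂ x du j := by
  intro t ht
  have ht' := P.faceRow_subset_farAS x du hj ht
  rw [farAS, mem_psBox_iff] at ht'
  rw [Icc_faceLo_faceHi, mem_psBox_iff] at ht
  have hr : (1 : ℤ) ≤ P.r (oth du.1) := by exact_mod_cast P.one_le_r (oth du.1)
  rw [farAS₂, mem_psBox_iff]
  exact ⟨ht'.1, by omega, by omega⟩

/-- **The `k`-enlargement of the face row lies in `farAS₂`** (`j + 1 ≤ K`, `k + 3 ≤ 10 s∥` along, `k + 3 ≤ 3 r⊥` across). [cite: KozmaNitzan2024, §4 p. 30] -/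
theorem faceRow_enlarge_subset_farAS₂ (x : Site 2) (du : MDir) {j k : ℕ} (hj : j + 1 ≤ P.K) (hk : k + 3 ≤ 10 * P.s du.1) (hk' : k + 3 ≤ 3 * P.r (oth du.1)) :
    Finset.Icc (P.faceLo x du j - (k : Site 2)) (P.faceHi x du j + (k : Site 2)) ⊆ P.farAS₂ x du j := by
  intro t ht
  have ht' := P.faceRow_enlarge_subset_farAS x du hj hk (by omega) ht
  rw [farAS, mem_psBox_iff] at ht'
  rw [Finset.mem_Icc] at ht
  have h1 := ht.1 (oth du.1)
  have h2 := ht.2 (oth du.1)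
  simp only [faceLo, faceHi, sLo, sHi, Pi.sub_apply, Pi.add_apply, Pi.natCast_apply, if_neg (oth_ne du.1)] at h1 h2
  have hkz : (k : ℤ) + 3 ≤ 3 * P.r (oth du.1) := by exact_mod_cast hk'
  rw [farAS₂, mem_psBox_iff]
  exact ⟨ht'.1, by omega, by omega⟩

/-- **The cube `Q_x` and `farAS₂` are ℓ^∞-gap separated.** [cite: KozmaNitzan2024, §4 p. 26 ((29))] -/
theorem Q_sepInf_farAS₂ (x : Site 2) (du : MDir) (j : ℕ) : SepInf (↑(P.Q x) : Set (Site 2)) ↑(P.farAS₂ x du j) :=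
  (P.Q_sepInf_farAS x du j).mono subset_rfl (Finset.coe_subset.2 (P.farAS₂_subset_farAS x du j))

/-- The stub `H^j` and `farAS₂` are ℓ^∞-gap separated. [cite: KozmaNitzan2024, §4 p. 30] -/
theorem Stub_sepInf_farAS₂ (x : Site 2) (du : MDir) (j : ℕ) : SepInf (↑(P.Stub x du j) : Set (Site 2)) ↑(P.farAS₂ x du j) :=
  (P.Stub_sepInf_farAS x du j).mono subset_rfl (Finset.coe_subset.2 (P.farAS₂_subset_farAS x du j))

/-- `farAN₂ ∩ Stub_j = ∅`. [folklore] -/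
theorem farAN₂_disjoint_Stub (x : Site 2) (du : MDir) (j : ℕ) : Disjoint (P.farAN₂ x du j) (P.Stub x du j) :=
  (P.farAN_disjoint_Stub x du j).mono_left (P.farAN₂_subset_farAN x du j)

/-- `farAS₂ ∩ Q_x = ∅`. [folklore] -/
theorem farAS₂_disjoint_Q (x : Site 2) (du : MDir) (j : ℕ) : Disjoint (P.farAS₂ x du j) (P.Q x) :=
  (P.farAS_disjoint_Q x du j).mono_left (P.farAS₂_subset_farAS x du j)

end PCells2

end Summit.CriticalPhenomena.PercolationContinuityZ3.Theorems.Transplant
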